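import Summits.CriticalPhenomena.PercolationContinuityZ3.Theorems.PercNearOneGluingNoHeavyLowerTailSunflowerC1SplittingCertificate
import HarnessLib

/-!
# `NoHeavyLowerTail` (crux stmt-CriticalPhenomena-4575), abstract sunflower cubic at LAW level: the GLADKOV SPLITTING property as a
# `Prop`, and (C1) from it

Support file (seat `prim-ineq-gen-2` gen 33; `--supports stmt-CriticalPhenomena-4575`).  No `sorry`, no computation, standard axioms.
Memo: run/shared/lean/prim/prim-ineq-gen-2/GLADKOV-SPLITTING-GEN33.md §2.

`HasGladkovSplitting F`: SOME 2-colouring `inB` of the 2-copy fibres makes the two Bernstein region certificates with `S₁ = AG_𝓑` (A-side) and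
`S₁' = AG_{𝓑ᶜ}` (B-side) pass — the existential form of the data-free check `checkSplit` (which tries ONE colouring, the canonical rule).
THE GLADKOV SPLITTING CONJECTURE (memo §2; verified by LP on ≈ 6 900 structures with n ≤ 9, no exception) is `∀ n (F : Sunflower (Fin n)),
HasGladkovSplitting F`; by `c1_of_hasGladkovSplitting` it implies (C1) for every sunflower at every bias.
-/

namespace Summit.CriticalPhenomena.PercolationContinuityZ3.Theorems.SunflowerPartition

namespace SafeCalc

namespace C1Cert

open Finset Bern

variable {n : ℕ}

/-- `F` ADMITS A GLADKOV SPLITTING: for some set `𝓑` of 2-copy fibres (`inB`), `LA − (a−b)·AG_𝓑` and `LB − (b−a)·AG_{𝓑ᶜ}` pass the scaled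
tensor-Bernstein test (as region certificates with `N = 1`, `S₂ = 0`).  Conjecture (memo §2): every sunflower does. [this work] -/
def HasGladkovSplitting (F : Sunflower (Fin n)) : Prop :=
  ∃ inB : Expo n 2 → Bool,
    certSide n (laArr F) (dArr F) 1 (splitS1 n (agBern F) inB) (zeroArr n 1) = true ∧
      certSide n (lbArr F) (ndArr F) 1 (splitS1 n (agBern F) fun β => !inB β) (zeroArr n 1) = true

/-- The canonical check exhibits a splitting. [this work] -/
theorem hasGladkovSplitting_of_checkSplit (F : Sunflower (Fin n)) (h : checkSplit F = true) : HasGladkovSplitting F := by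
  simp only [checkSplit, Bool.and_eq_true] at h
  exact ⟨_, h.1, h.2⟩

/-- **(C1) from a Gladkov splitting**: `e₃(c) ≤ max(a,b)·(ab − e₂(c))` for the cell masses of `F` at every bias `x ∈ [0,1]^n`. [this work] -/
theorem c1_of_hasGladkovSplitting (F : Sunflower (Fin n)) (h : HasGladkovSplitting F) (x : Fin n → ℝ)
    (hx : ∀ i, 0 ≤ x i ∧ x i ≤ 1) :
    cellMass F 1 x * cellMass F 2 x * cellMass F 3 x ≤
      max (cellMass F 4 x) (cellMass F 0 x) *
        (cellMass F 4 x * cellMass F 0 x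
          - (cellMass F 1 x * cellMass F 2 x + cellMass F 1 x * cellMass F 3 x + cellMass F 2 x * cellMass F 3 x)) := by
  obtain ⟨_, hA, hB⟩ := h
  exact c1_of_certs F hA hB x hx

/-- **The conjecture, as a `Prop`** (memo §2): every three-petal sunflower of up-sets on finitely many coins admits a Gladkov splitting.
NOT proved; stated for reference (it implies (C1) at every bias for every sunflower, and prove-1's comb-positivity of `H`). [this work] -/
def GladkovSplittingConjecture : Prop := ∀ (n : ℕ) (F : Sunflower (Fin n)), HasGladkovSplitting F

/-- The conjecture implies (C1) for every sunflower at every bias. [this work] -/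
theorem c1_of_gladkovSplittingConjecture (h : GladkovSplittingConjecture) {n : ℕ} (F : Sunflower (Fin n)) (x : Fin n → ℝ)
    (hx : ∀ i, 0 ≤ x i ∧ x i ≤ 1) :
    cellMass F 1 x * cellMass F 2 x * cellMass F 3 x ≤
      max (cellMass F 4 x) (cellMass F 0 x) *
        (cellMass F 4 x * cellMass F 0 x
          - (cellMass F 1 x * cellMass F 2 x + cellMass F 1 x * cellMass F 3 x + cellMass F 2 x * cellMass F 3 x)) :=
  c1_of_hasGladkovSplitting F (h n F) x hx

end C1Cert

end SafeCalc

end Summit.CriticalPhenomena.PercolationContinuityZ3.Theorems.SunflowerPartition
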